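import Mathlib
import HarnessLib

/-!
# LEMMA S — a first-order MOVING package splits the restricted elementary transform (negative lemma for K2ᵀᴿ, rung-1 g7)

Crux `stmt-HodgeConjecture-27388` (K2ᵀᴿ, `Theses.KleimanBFSeeds.TwistNormalisedKleimanSemiregularAnchorR`), line
`Cruxes/TwistNormalisedKleimanSemiregularAnchorR/Lines/chosen_anchor.lean`, step (1½c) (σ-row of the re-framed sheaf `E′`).
HONEST LABEL: a `--supports` helper (Negative/ lane); it neither proves nor refutes the rung, `stub_good`, K2ᵀᴿ, K2ᵀ,
`WeilSixfolds`, HC_AV, HC_CM or HC. It is the KERNEL form of the commutative-algebra core of LEMMA S (hodge-idea-1 g17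
`SECOND-VOICE-g17.md` rev 2 §1; re-derived in `TRIAGE-r1-1.md`), the lemma that killed the σ-bicartesian ∕ LS₄ criterion of
the idea card `hecke-saturation-parallel-fibres` on every support-moving R♮ package. The sheaf-theoretic dressing
(restriction to the fibre `D`, `Tor₁`-identification `Q ⊗ N_D^∨ = sĒ/sK̃`, Quot-scheme tangent vectors) is PEN, §1.

## §1 The pen chain (what the lemmas are the shadow of)

SETTING (SECOND-VOICE §1): `f : P → B` smooth to a curve, `D = f⁻¹(t₀)` with local equation `s`, `2D = f⁻¹(Spec ℂ[s]/s²)`;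
`E` locally free on `P`, `Q` a locally free quotient of `E_D`, `K = ker(E_D ↠ Q)`, `E′ = ker(E ↠ ι_*Q)` the elementary
transform. HYPOTHESIS (MV) «the package moves to first order»: `Q` extends to a quotient `q : Ē := E|_{2D} ↠ 𝒬` FLAT over
`ℂ[s]/s²` (`ker(s : 𝒬 → 𝒬) = s𝒬`), `K̃ := ker q`. LEMMA S: the restricted sequence `0 → Q ⊗ N_D^∨ → E′_D → K → 0` SPLITS —
`E′/sE′ = (K̃ + sĒ)/sK̃`, and flatness gives **`K̃ ∩ sĒ = sK̃`** (if `se ∈ K̃` then `s·q(e) = 0`, so `q(e) = s·q(e″)`,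
`e − se″ ∈ K̃`, and `se = s(e − se″)` as `s² = 0`); hence `K̃/sK̃ ↪ Ē/sĒ = E_D` with image `K`, i.e. `K̃ mod s` is a copy of
`K` inside `E′_D` lifting `E′_D ↠ K`, and `E′_D = (sĒ/sK̃) ⊕ (K̃/sK̃) = (Q ⊗ N^∨) ⊕ K`. CONSEQUENCE (LEMMA J, pen): at a split
fibre `Ext²_D(Q, E′_D) ⊇ H²(𝒪_D)·id_Q ≠ 0` (LS₄ false) and `j^* : Ext²(E,E′) → Ext²(E′,E′)` is not onto.

## §2 What is proved (modules over a commutative ring `R`, an element `s`, pointwise scalar action on submodules)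

* `exists_sub_smul_mem_of_quotient_flat` — (MV) in module form: if `ker(s•) ⊆ range(s•)` on `M ⧸ K` then
  `∀ e, s • e ∈ K → ∃ e′, e − s • e′ ∈ K` (hypothesis (H) below).
* `inf_pointwise_smul_top_eq` — **LEMMA S core**: under (H) and `s • (s • m) = 0` on `M`: `K ⊓ (s • ⊤) = s • K`.
* `pointwise_smul_sup_eq` — `s • (K ⊔ s • ⊤) = s • K` (`s² = 0`): «`sE′ = sK̃`».
* `lemmaS_splitting` — the splitting in membership form: for `N := K ⊔ s • ⊤` (= `E′ mod s²`), if `k ∈ K` and `k − s•m ∈ s • N`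
  then `k ∈ s • N` and `s • m ∈ s • N` — the images of `K` and of `sM` in `N/sN` meet trivially (and they span), i.e.
  `N/sN = (K̃/sK̃) ⊕ (sĒ/sK̃)`.
* `trace_smul_id_ne_zero` — LEMMA J's arithmetic shadow: `r • α ≠ 0` for `α ≠ 0`, `r ≠ 0` in a torsion-free module over a
  domain (the trace `tr(α · id_Q) = r·α`, `r = rk Q`, characteristic `0`).
-/

set_option linter.dupNamespace false

open Pointwise

namespace Summit.HodgeConjecture.HodgeConjecture.Theorems.TwistNormalisedKleimanSemiregularAnchorR.Negative.LemmaSPackageSplitting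

variable {R : Type*} [CommRing R] {M : Type*} [AddCommGroup M] [Module R M]

/-- **(MV) ⇒ (H)**: if on the quotient `M ⧸ K` (the first-order package `𝒬`) every `s`-torsion element is an `s`-multiple
(flatness over `ℂ[s]/s²`: `ker s = s𝒬`), then every `e ∈ M` with `s • e ∈ K` is congruent mod `K` to an `s`-multiple.
[cite: HuybrechtsLehn1997, §2.2 (Quot scheme tangent space) and §2.A (flatness)] -/
theorem exists_sub_smul_mem_of_quotient_flat (K : Submodule R M) (s : R)
    (hflat : ∀ x : M ⧸ K, s • x = 0 → ∃ y : M ⧸ K, x = s • y) (e : M) (he : s • e ∈ K) :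
    ∃ e' : M, e - s • e' ∈ K := by
  have h0 : s • (Submodule.Quotient.mk e : M ⧸ K) = 0 := by
    rw [← Submodule.Quotient.mk_smul, Submodule.Quotient.mk_eq_zero]
    exact he
  obtain ⟨y, hy⟩ := hflat _ h0
  obtain ⟨e', rfl⟩ := Submodule.Quotient.mk_surjective K y
  refine ⟨e', ?_⟩
  rw [← Submodule.Quotient.eq, hy, Submodule.Quotient.mk_smul]

/-- **LEMMA S, core identity `K̃ ∩ sĒ = sK̃`**: under (H) (`s • e ∈ K ⇒ e ≡ s • e′ mod K`) and `s² = 0` on `M`,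
`K ⊓ (s • ⊤) = s • K` as submodules of `M`. [cite: HuybrechtsLehn1997, §2.2] -/
theorem inf_pointwise_smul_top_eq (K : Submodule R M) (s : R) (hs : ∀ m : M, s • (s • m) = 0)
    (hH : ∀ e : M, s • e ∈ K → ∃ e' : M, e - s • e' ∈ K) :
    K ⊓ (s • (⊤ : Submodule R M)) = s • K := by
  apply le_antisymm
  · rintro m ⟨hmK, hms⟩
    rw [SetLike.mem_coe, Submodule.mem_smul_pointwise_iff_exists] at hms
    obtain ⟨e, -, rfl⟩ := hms
    obtain ⟨e', he'⟩ := hH e hmK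
    rw [Submodule.mem_smul_pointwise_iff_exists]
    refine ⟨e - s • e', he', ?_⟩
    rw [smul_sub, hs, sub_zero]
  · intro m hm
    rw [Submodule.mem_smul_pointwise_iff_exists] at hm
    obtain ⟨k, hk, rfl⟩ := hm
    refine ⟨K.smul_mem s hk, ?_⟩
    rw [SetLike.mem_coe, Submodule.mem_smul_pointwise_iff_exists]
    exact ⟨k, Submodule.mem_top, rfl⟩

/-- **`sE′ = sK̃`**: with `N := K ⊔ s • ⊤` (the elementary transform modulo `s²`) and `s² = 0` on `M`, `s • N = s • K`.
[folklore] -/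
theorem pointwise_smul_sup_eq (K : Submodule R M) (s : R) (hs : ∀ m : M, s • (s • m) = 0) :
    s • (K ⊔ s • (⊤ : Submodule R M)) = s • K := by
  apply le_antisymm
  · intro m hm
    rw [Submodule.mem_smul_pointwise_iff_exists] at hm
    obtain ⟨n, hn, rfl⟩ := hm
    obtain ⟨k, hk, t, ht, rfl⟩ := Submodule.mem_sup.mp hn
    rw [Submodule.mem_smul_pointwise_iff_exists] at ht
    obtain ⟨u, -, rfl⟩ := ht
    rw [smul_add, hs, add_zero, Submodule.mem_smul_pointwise_iff_exists]
    exact ⟨k, hk, rfl⟩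
  · intro m hm
    rw [Submodule.mem_smul_pointwise_iff_exists] at hm ⊢
    obtain ⟨k, hk, rfl⟩ := hm
    exact ⟨k, Submodule.mem_sup_left hk, rfl⟩

/-- **LEMMA S, the splitting** `E′_D = (Q ⊗ N^∨) ⊕ K` in membership form: with `N := K ⊔ s • ⊤`, if `k ∈ K` and `m ∈ M`
have the same image in `N/sN` (`k − s • m ∈ s • N`) then both images vanish (`k ∈ s • N`, `s • m ∈ s • N`) — the images
of `K̃` and of `sĒ` in `E′_D = N/sN` intersect trivially (and span `N/sN` by definition of `N`).
[cite: HuybrechtsLehn1997, §2.2] -/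
theorem lemmaS_splitting (K : Submodule R M) (s : R) (hs : ∀ m : M, s • (s • m) = 0)
    (hH : ∀ e : M, s • e ∈ K → ∃ e' : M, e - s • e' ∈ K) (k : M) (hk : k ∈ K) (m : M)
    (hkm : k - s • m ∈ s • (K ⊔ s • (⊤ : Submodule R M))) :
    k ∈ s • (K ⊔ s • (⊤ : Submodule R M)) ∧ s • m ∈ s • (K ⊔ s • (⊤ : Submodule R M)) := by
  have hsN := pointwise_smul_sup_eq K s hs
  rw [hsN] at hkm ⊢
  -- `k - s•m = s•k₀` with `k₀ ∈ K`, so `k = s•(m + k₀) ∈ K ⊓ s•⊤ = s•K`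
  have hk' : k ∈ s • K := by
    rw [← inf_pointwise_smul_top_eq K s hs hH]
    refine ⟨hk, ?_⟩
    rw [Submodule.mem_smul_pointwise_iff_exists] at hkm
    obtain ⟨k₀, -, hk₀⟩ := hkm
    rw [SetLike.mem_coe, Submodule.mem_smul_pointwise_iff_exists]
    refine ⟨m + k₀, Submodule.mem_top, ?_⟩
    rw [smul_add, hk₀]; abel
  refine ⟨hk', ?_⟩
  have : s • m = k - (k - s • m) := by abel
  rw [this]
  exact Submodule.sub_mem _ hk' hkm

/-- **LEMMA J's arithmetic shadow**: `tr(α · id_Q) = r · α ≠ 0` for `α ≠ 0` and `r = rk Q ≠ 0` — in a torsion-free module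
over a domain (characteristic `0` cohomology `H²(𝒪_D)`), a non-zero natural multiple of a non-zero class is non-zero.
[folklore] -/
theorem trace_smul_id_ne_zero {S : Type*} [CommRing S] [IsDomain S] [CharZero S] {V : Type*} [AddCommGroup V]
    [Module S V] [NoZeroSMulDivisors S V] (r : ℕ) (hr : r ≠ 0) (α : V) (hα : α ≠ 0) : (r : S) • α ≠ 0 := by
  rw [Ne, smul_eq_zero, not_or]
  exact ⟨Nat.cast_ne_zero.mpr hr, hα⟩

end Summit.HodgeConjecture.HodgeConjecture.Theorems.TwistNormalisedKleimanSemiregularAnchorR.Negative.LemmaSPackageSplitting
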